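import Summits.Ventures.HSemireg.WedgeHankelRecurrenceGaussHermiteResultantGapTwo

/-!
# Venture HSemireg — **GAUSS NODES ARE LIPSCHITZ IN THE RECURRENCE COEFFICIENTS**: Hoffman–Wielandt (N417) read directly in the monic data `(a, b)`:
# **`Σ_k (y_k − x_k)² ≤ Σ_{i≤t} (a'_i − a_i)² + 2 Σ_{i<t} |b'_{i+1} − b_{i+1}|`** (Hölder form, `(√u−√v)² ≤ |u−v|`) and
# **`Σ_k (y_k − x_k)² ≤ Σ_{i≤t} (a'_i − a_i)² + Σ_{i<t} (b'_{i+1} − b_{i+1})² ∕ (2 min(b_{i+1}, b'_{i+1}))`** (Lipschitz form, `(√u−√v)² ≤ (u−v)²∕(4 min(u,v))`)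

HONEST FRAMING. Part of the Lean index of the computation cell `pub-hsemireg` (seat p10 gen 47, Sunday typer «UNIFORM-IN-n»).  `Real.sqrt`, `min`, absolute values and finite sums only; no variety,
no cohomology theory, no sheaf, no Ext group and no semiregularity map is constructed here; nothing here says that HC / HC_CM / HC_AV holds; no Literature fact (unproved `Prop`) is declared or
used.  Custodian versions as in `WedgeHankelSiegelIdeal` (1/3).
SOURCES (cited).  A. J. Hoffman, H. W. Wielandt, Duke Math. J. 20 (1953) 37–39; W. Gautschi, *Orthogonal Polynomials: Computation and Approximation* (2004), §3.1.1–3.1.2 (sensitivity ∕ condition of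
the map from the recurrence coefficients to the Gauss nodes); D. P. Laurie, *Accurate recovery of recursion coefficients from Gaussian quadrature formulas*, J. Comput. Appl. Math. 112 (1999)
165–180.  Both bounds are COROLLARIES typed here of N417.
PROOF TYPED HERE.  N417 `hoffman_wielandt_recurrence`; `Literature.Analysis.FunctionSpaces.sq_sqrt_sub_sqrt_le` (via N424's import); `(√u − √v)(√u + √v) = u − v` and `(√u + √v)² ≥ 4 min(u, v)`.
DEDUP DISCLOSURE (`rg -n -i 'lipschitz|hoffman_wielandt_abs' Summits/Ventures/HSemireg`, 2026-09-04): N424 (equal diagonals, Laguerre); 0 hits for the 3 names below.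

WHAT IS IN THE TREE.  N417 `hoffman_wielandt_recurrence`; `Literature.Analysis.FunctionSpaces.sq_sqrt_sub_sqrt_le`.
THIS FILE (namespace `Summit.Ventures.HSemireg.Wedge.HankelOuter` continued; CHAINED on N428 (import only); 0 definitions):
* §1194 `sqrt_sub_sqrt_sq_le_div` (`(√u − √v)² ≤ (u − v)² ∕ (4 min(u,v))`, `u, v > 0`), **`hoffman_wielandt_abs`**, **`hoffman_wielandt_lipschitz`**.
CAVEATS.  Both recurrences positive, same size, zeros increasing (as N417).  Nothing Ext-side.  New names only.
-/

open Module Polynomial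
open scoped Matrix Polynomial

namespace Summit.Ventures.HSemireg.Wedge.HankelOuter

/-! ## §1194. Hoffman–Wielandt in the monic recurrence data -/

/-- `(√u − √v)² ≤ (u − v)² ∕ (4 min(u, v))` for `u, v > 0`. [bookkeeping; this file, §1194] -/
theorem sqrt_sub_sqrt_sq_le_div {u v : ℝ} (hu : 0 < u) (hv : 0 < v) : (Real.sqrt u - Real.sqrt v) ^ 2 ≤ (u - v) ^ 2 / (4 * min u v) := by
  have hsu := Real.sqrt_pos.2 hu
  have hsv := Real.sqrt_pos.2 hv
  have hm : 0 < min u v := lt_min hu hv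
  have h1 : (Real.sqrt u - Real.sqrt v) * (Real.sqrt u + Real.sqrt v) = u - v := by nlinarith [Real.mul_self_sqrt hu.le, Real.mul_self_sqrt hv.le]
  -- `(√u + √v)² ≥ 4 min(u,v)`
  have hsm : Real.sqrt (min u v) ≤ Real.sqrt u := Real.sqrt_le_sqrt (min_le_left u v)
  have hsm' : Real.sqrt (min u v) ≤ Real.sqrt v := Real.sqrt_le_sqrt (min_le_right u v)
  have hmm : Real.sqrt (min u v) * Real.sqrt (min u v) = min u v := Real.mul_self_sqrt hm.le
  have h2 : 4 * min u v ≤ (Real.sqrt u + Real.sqrt v) ^ 2 := by nlinarith [Real.sqrt_nonneg (min u v)]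
  rw [le_div_iff₀ (by positivity)]
  calc (Real.sqrt u - Real.sqrt v) ^ 2 * (4 * min u v) ≤ (Real.sqrt u - Real.sqrt v) ^ 2 * (Real.sqrt u + Real.sqrt v) ^ 2 :=
        mul_le_mul_of_nonneg_left h2 (sq_nonneg _)
    _ = (u - v) ^ 2 := by rw [← mul_pow, h1]

/-- **HÖLDER FORM: `Σ_k (y_k − x_k)² ≤ Σ_{i≤t} (a'_i − a_i)² + 2 Σ_{i<t} |b'_{i+1} − b_{i+1}|`.** [corollary of Hoffman–Wielandt 1953; Gautschi §3.1; this file, §1194] -/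
theorem hoffman_wielandt_abs {q q' : ℕ → ℝ[X]} {a a' b b' : ℕ → ℝ} (hq0 : q 0 = 1) (hq1 : q 1 = Polynomial.X - C (a 0))
    (hrec : ∀ n, q (n + 2) = (Polynomial.X - C (a (n + 1))) * q (n + 1) - C (b (n + 1)) * q n) (hq0' : q' 0 = 1) (hq1' : q' 1 = Polynomial.X - C (a' 0))
    (hrec' : ∀ n, q' (n + 2) = (Polynomial.X - C (a' (n + 1))) * q' (n + 1) - C (b' (n + 1)) * q' n) (hb : ∀ j, 0 < b j) (hb' : ∀ j, 0 < b' j) {t : ℕ}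
    {x y : Fin (t + 1) → ℝ} (hx : StrictMono x) (hxq : q (t + 1) = ∏ k, (Polynomial.X - C (x k))) (hy : StrictMono y) (hyq : q' (t + 1) = ∏ k, (Polynomial.X - C (y k))) :
    ∑ k, (y k - x k) ^ 2 ≤ ∑ i ∈ Finset.range (t + 1), (a' i - a i) ^ 2 + 2 * ∑ i ∈ Finset.range t, |b' (i + 1) - b (i + 1)| :=
  (hoffman_wielandt_recurrence hq0 hq1 hrec hq0' hq1' hrec' hb hb' hx hxq hy hyq).trans (by
    gcongr with i hi
    exact Literature.Analysis.FunctionSpaces.sq_sqrt_sub_sqrt_le (hb' (i + 1)).le (hb (i + 1)).le)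

/-- **LIPSCHITZ FORM: `Σ_k (y_k − x_k)² ≤ Σ_{i≤t} (a'_i − a_i)² + Σ_{i<t} (b'_{i+1} − b_{i+1})² ∕ (2 min(b_{i+1}, b'_{i+1}))`.** [corollary of Hoffman–Wielandt 1953; Gautschi §3.1.2; Laurie 1999;
this file, §1194] -/
theorem hoffman_wielandt_lipschitz {q q' : ℕ → ℝ[X]} {a a' b b' : ℕ → ℝ} (hq0 : q 0 = 1) (hq1 : q 1 = Polynomial.X - C (a 0))
    (hrec : ∀ n, q (n + 2) = (Polynomial.X - C (a (n + 1))) * q (n + 1) - C (b (n + 1)) * q n) (hq0' : q' 0 = 1) (hq1' : q' 1 = Polynomial.X - C (a' 0))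
    (hrec' : ∀ n, q' (n + 2) = (Polynomial.X - C (a' (n + 1))) * q' (n + 1) - C (b' (n + 1)) * q' n) (hb : ∀ j, 0 < b j) (hb' : ∀ j, 0 < b' j) {t : ℕ}
    {x y : Fin (t + 1) → ℝ} (hx : StrictMono x) (hxq : q (t + 1) = ∏ k, (Polynomial.X - C (x k))) (hy : StrictMono y) (hyq : q' (t + 1) = ∏ k, (Polynomial.X - C (y k))) :
    ∑ k, (y k - x k) ^ 2 ≤ ∑ i ∈ Finset.range (t + 1), (a' i - a i) ^ 2 + ∑ i ∈ Finset.range t, (b' (i + 1) - b (i + 1)) ^ 2 / (2 * min (b (i + 1)) (b' (i + 1))) := by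
  refine (hoffman_wielandt_recurrence hq0 hq1 hrec hq0' hq1' hrec' hb hb' hx hxq hy hyq).trans ?_
  rw [Finset.mul_sum]
  gcongr with i hi
  have h := sqrt_sub_sqrt_sq_le_div (hb' (i + 1)) (hb (i + 1))
  have hm : 0 < min (b (i + 1)) (b' (i + 1)) := lt_min (hb _) (hb' _)
  rw [min_comm] at h
  calc 2 * (Real.sqrt (b' (i + 1)) - Real.sqrt (b (i + 1))) ^ 2 ≤ 2 * ((b' (i + 1) - b (i + 1)) ^ 2 / (4 * min (b (i + 1)) (b' (i + 1)))) := by linarith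
    _ = (b' (i + 1) - b (i + 1)) ^ 2 / (2 * min (b (i + 1)) (b' (i + 1))) := by field_simp; ring

end Summit.Ventures.HSemireg.Wedge.HankelOuter
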